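import Summits.CriticalPhenomena.SAWScalingLimit.Theorems.SAWRenewalTightnessTubeLowerBoundDefs
import Literature.Probability.RandomPlanarGeometry.SAWReflect

/-!
# Crux `TubeLowerBound` (stmt-CriticalPhenomena-4730), line `lieb-simon-star`: stub S3 `stub_mirrorPin`

`OneSidedReach → HalfTubePieceFloor`: Madras–Slade's reflect-and-Schwarz (N. Madras, G. Slade, *The Self-Avoiding
Walk* (1993), Lemma 4.1.12) applied once to the one-sided reach family.  For `L = 2X + 1 + ε` (`ε ∈ {0,1}`,
`X ≥ 1`) glue a reach walk `ω` of the flat box `[0, X] × [0, X/5]` ending on the column `x = X` at height `y`, the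
`1 + ε` bridging steps, and the time-reversed mirror image under `x ↦ L − x` of a second reach walk `ω'` with the
same end height: a self-avoiding walk `0 → (L, 0)` inside `[0, L] × [0, L/10]`, injectively in `(ω, ω')`.
Cauchy–Schwarz over the `X + 1` end heights turns the point-to-column floor `c X^{−C}` into the pointwise floor
`(x_c² c²/2) L^{−(2C+1)}`; `L ∈ {1, 2}` is the straight walk.  Only `0 < x_c ≤ 1` is used about `x_c`.
No new definitions: the two families, the east extension and the gluing relation are local notations.
-/

noncomputable section

namespace Summit.CriticalPhenomena.SAWScalingLimit.Theorems.TubeLowerBound.LiebSimonStar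

open scoped BigOperators Classical
open Literature.Probability.LatticeModels
open Literature.Probability.RandomPlanarGeometry Literature.Probability.RandomPlanarGeometry.SAW

set_option quotPrecheck false in
/-- `RF[X, n]`: the family of `OneSidedReach` at width `X` and length `n` (self-avoiding walks from `0` with all
vertices in `0 ≤ x ≤ X`, `0 ≤ y`, `5 y ≤ X`, ending on the column `x = X`). -/
local notation "RF[" X ", " n "]" => Finset.filter (fun ω : ℕ → Site 2 =>
  (∀ i ≤ n, 0 ≤ ω i 0 ∧ ω i 0 ≤ ((X : ℕ) : ℤ) ∧ 0 ≤ ω i 1 ∧ 5 * ω i 1 ≤ ((X : ℕ) : ℤ)) ∧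
    ω n 0 = ((X : ℕ) : ℤ)) (Zd.saws 2 n)

set_option quotPrecheck false in
/-- `TF[L, n]`: the family of `HalfTubePieceFloor` at scale `L` and length `n` (self-avoiding walks `0 → (L, 0)`
inside the half-tube `[0, L] × [0, L/10]`). -/
local notation "TF[" L ", " n "]" => Finset.filter (fun ω : ℕ → Site 2 =>
  ∀ i ≤ n, 0 ≤ ω i 0 ∧ ω i 0 ≤ ((L : ℕ) : ℤ) ∧ 0 ≤ ω i 1 ∧ 10 * ω i 1 ≤ ((L : ℕ) : ℤ))
    (Zd.sawFun 2 n ![((L : ℕ) : ℤ), 0])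

/-- `EXT[ε, m, ω]`: the `m`-step walk `ω` followed by `ε` unit steps east. -/
local notation "EXT[" ε ", " m ", " ω "]" => Zd.concatWalk m ω (Zd.straightWalk 2 ε)

set_option quotPrecheck false in
/-- `Glues[L, p, q, h, t, γ]`: `γ` is the head `h` up to time `p`, then the mirror image under `x ↦ L − x`
(`Zd.reflAt 0 L`) of the tail `t` run backwards from time `q` to time `0` (frozen at `reflAt 0 L (t 0)` from
time `p + 1 + q` on). -/
local notation "Glues[" L ", " p ", " q ", " h ", " t ", " γ "]" =>
  ∀ i : ℕ, (γ : ℕ → Site 2) i = if i ≤ p then (h : ℕ → Site 2) i else Zd.reflAt 0 L (t (p + 1 + q - i))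

/-! ### Gluing a head to the reversed mirror image of a tail -/

/-- Before the cut a glued function is the head. -/
theorem mirrorPin_glue_apply_of_le {L : ℤ} {p q : ℕ} {h t γ : ℕ → Site 2} (hγ : Glues[L, p, q, h, t, γ]) {i : ℕ}
    (hi : i ≤ p) : γ i = h i := by rw [hγ, if_pos hi]

/-- After the cut a glued function is the reflected reversed tail. -/
theorem mirrorPin_glue_apply_of_lt {L : ℤ} {p q : ℕ} {h t γ : ℕ → Site 2} (hγ : Glues[L, p, q, h, t, γ]) {i : ℕ}
    (hi : p < i) : γ i = Zd.reflAt 0 L (t (p + 1 + q - i)) := by rw [hγ, if_neg (Nat.not_le.2 hi)]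

/-- The mirror image of the origin under `x ↦ L − x` is `(L, 0)`. -/
theorem mirrorPin_reflAt_zero (L : ℤ) : Zd.reflAt 0 L (0 : Site 2) = ![L, 0] := by
  funext j; fin_cases j <;> simp [Zd.reflAt]

/-- **Gluing criterion.** If `h` is a `p`-step and `t` a `q`-step self-avoiding walk from `0`, the junction
`h p → reflAt 0 L (t q)` is a lattice step, and no column of the head is the mirror image of a column of the
tail (`h i 0 + t j 0 ≠ L`), then the glued function is a `(p + 1 + q)`-step self-avoiding walk `0 → (L, 0)`. -/
theorem mirrorPin_glue_mem_sawFun {L : ℤ} {p q : ℕ} {h t γ : ℕ → Site 2} (hγ : Glues[L, p, q, h, t, γ])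
    (hh : h ∈ Zd.saws 2 p) (ht : t ∈ Zd.saws 2 q) (hjct : (zdGraph 2).Adj (h p) (Zd.reflAt 0 L (t q)))
    (hsep : ∀ i ≤ p, ∀ j ≤ q, h i 0 + t j 0 ≠ L) : γ ∈ Zd.sawFun 2 (p + 1 + q) ![L, 0] := by
  obtain ⟨h0, -, hadj, hinj⟩ := Zd.mem_saws.1 hh
  obtain ⟨t0, -, tadj, tinj⟩ := Zd.mem_saws.1 ht
  refine Zd.mem_sawFun.2 ⟨?_, ?_, ?_, ?_⟩
  · rw [mirrorPin_glue_apply_of_le hγ (Nat.zero_le p), h0]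
  · intro i hi
    rw [mirrorPin_glue_apply_of_lt hγ (by omega), show p + 1 + q - i = 0 by omega, t0, mirrorPin_reflAt_zero]
  · intro i hi
    rcases lt_trichotomy (i + 1) (p + 1) with hlt | heq | hgt
    · rw [mirrorPin_glue_apply_of_le hγ (by omega), mirrorPin_glue_apply_of_le hγ (by omega)]
      exact hadj i (by omega)
    · obtain rfl : i = p := by omega
      rw [mirrorPin_glue_apply_of_le hγ le_rfl, mirrorPin_glue_apply_of_lt hγ (Nat.lt_succ_self i),
        show i + 1 + q - (i + 1) = q by omega]
      exact hjct
    · rw [mirrorPin_glue_apply_of_lt hγ (by omega), mirrorPin_glue_apply_of_lt hγ (by omega), Zd.zdGraph_adj_reflAt,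
        show p + 1 + q - i = (p + 1 + q - (i + 1)) + 1 by omega]
      exact (tadj _ (by omega)).symm
  · intro i hi j hj hij
    simp only [Set.mem_setOf_eq] at hi hj
    by_cases hip : i ≤ p <;> by_cases hjp : j ≤ p
    · rw [mirrorPin_glue_apply_of_le hγ hip, mirrorPin_glue_apply_of_le hγ hjp] at hij
      exact hinj (show i ≤ p from hip) (show j ≤ p from hjp) hij
    · have e := congrFun hij 0
      rw [mirrorPin_glue_apply_of_le hγ hip, mirrorPin_glue_apply_of_lt hγ (Nat.not_le.1 hjp), Zd.reflAt_apply_same] at e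
      exact absurd e (by have := hsep i hip (p + 1 + q - j) (by omega); omega)
    · have e := congrFun hij 0
      rw [mirrorPin_glue_apply_of_lt hγ (Nat.not_le.1 hip), mirrorPin_glue_apply_of_le hγ hjp, Zd.reflAt_apply_same] at e
      exact absurd e (by have := hsep j hjp (p + 1 + q - i) (by omega); omega)
    · rw [mirrorPin_glue_apply_of_lt hγ (Nat.not_le.1 hip), mirrorPin_glue_apply_of_lt hγ (Nat.not_le.1 hjp)] at hij
      have e := tinj (show p + 1 + q - i ≤ q by omega) (show p + 1 + q - j ≤ q by omega)
        (Zd.reflAt_injective 0 L hij)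
      omega

/-! ### Reach walks and their east extension -/

/-- A reach walk of length `m` is frozen from time `m` on. -/
theorem mirrorPin_reach_frozen {X m : ℕ} {ω : ℕ → Site 2} (hω : ω ∈ RF[X, m]) : ∀ i, m ≤ i → ω i = ω m :=
  (Zd.mem_saws.1 (Finset.mem_filter.1 hω).1).2.1

/-- Up to time `m` the east extension is `ω`. -/
theorem mirrorPin_ext_apply_of_le {ε m : ℕ} {ω : ℕ → Site 2} {i : ℕ} (hi : i ≤ m) : EXT[ε, m, ω] i = ω i :=
  if_pos hi

/-- From time `m` on the east extension is `ω m` shifted east by `min (i − m) ε`. -/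
theorem mirrorPin_ext_apply_of_ge {ε m : ℕ} {ω : ℕ → Site 2} {i : ℕ} (hi : m ≤ i) :
    EXT[ε, m, ω] i = ω m + Pi.single 0 ((min (i - m) ε : ℕ) : ℤ) := by
  rcases hi.lt_or_eq with hlt | rfl
  · exact if_neg (Nat.not_le.2 hlt)
  · simp [Zd.concatWalk]

/-- The east extension of a reach walk: a self-avoiding walk of length `m + ε` in the columns `[0, X + ε]` with
the heights of `ω`, ending at `(X + ε, ω m 1)`. -/
theorem mirrorPin_ext_spec {X ε m : ℕ} {ω : ℕ → Site 2} (hω : ω ∈ RF[X, m]) :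
    EXT[ε, m, ω] ∈ Zd.saws 2 (m + ε) ∧
    (∀ i ≤ m + ε, 0 ≤ EXT[ε, m, ω] i 0 ∧ EXT[ε, m, ω] i 0 ≤ (X : ℤ) + ε ∧
      0 ≤ EXT[ε, m, ω] i 1 ∧ 5 * EXT[ε, m, ω] i 1 ≤ (X : ℤ)) ∧
    EXT[ε, m, ω] (m + ε) 0 = (X : ℤ) + ε ∧ EXT[ε, m, ω] (m + ε) 1 = ω m 1 := by
  obtain ⟨hωs, hbox, hend⟩ := Finset.mem_filter.1 hω
  have key : ∀ i, m ≤ i →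
      EXT[ε, m, ω] i 0 = (X : ℤ) + ((min (i - m) ε : ℕ) : ℤ) ∧ EXT[ε, m, ω] i 1 = ω m 1 := by
    intro i hi
    rw [mirrorPin_ext_apply_of_ge hi]
    simp [hend]
  refine ⟨?_, fun i hi => ?_, ?_, (key (m + ε) (Nat.le_add_right m ε)).2⟩
  · refine Zd.concatWalk_mem_saws hωs (Zd.straightWalk_mem_saws 2 ε) fun i hi j hj1 hjε e => ?_
    have e0 := congrFun e 0
    simp only [Pi.add_apply, Zd.straightWalk, Pi.single_eq_same, min_eq_left hjε, hend] at e0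
    have := (hbox i hi).2.1
    omega
  · rcases le_or_gt i m with him | him
    · rw [mirrorPin_ext_apply_of_le him]
      obtain ⟨h1, h2, h3, h4⟩ := hbox i him
      exact ⟨h1, by omega, h3, h4⟩
    · obtain ⟨e0, e1⟩ := key i him.le
      rw [e0, e1]
      have hmin : (min (i - m) ε : ℕ) ≤ ε := min_le_right _ _
      obtain ⟨-, -, h3, h4⟩ := hbox m le_rfl
      exact ⟨by positivity, by omega, h3, h4⟩
  · rw [(key (m + ε) (Nat.le_add_right m ε)).1]
    simp

/-! ### The mirror pin of a pair and its decoding -/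

/-- **The mirror pin lands in the half-tube family.** For reach walks `ω`, `ω'` of width `X` with the same end
height and `L = 2X + 1 + ε`, `ε ≤ 1`, the glued walk (`ω`, bridge, reversed mirror image of `ω'`) is a
self-avoiding walk `0 → (L, 0)` of length `m + 1 + (m' + ε)` inside `[0, L] × [0, L/10]`. -/
theorem mirrorPin_pin_mem_tubeFam {X ε L m m' : ℕ} (hL : L = 2 * X + 1 + ε) (hε : ε ≤ 1) {ω ω' γ : ℕ → Site 2}
    (hγ : Glues[L, m, m' + ε, ω, EXT[ε, m', ω'], γ]) (hω : ω ∈ RF[X, m]) (hω' : ω' ∈ RF[X, m'])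
    (hy : ω m 1 = ω' m' 1) : γ ∈ TF[L, m + 1 + (m' + ε)] := by
  obtain ⟨ht, tbox, tend0, tend1⟩ := mirrorPin_ext_spec (ε := ε) hω'
  obtain ⟨hωs, hbox, hend⟩ := Finset.mem_filter.1 hω
  have hLz : (L : ℤ) = 2 * X + 1 + ε := by rw [hL]; push_cast; ring
  rw [Finset.mem_filter]
  refine ⟨mirrorPin_glue_mem_sawFun hγ hωs ht ?_ ?_, ?_⟩
  · rw [Zd.zdGraph_adj_iff_sub]
    refine ⟨0, Or.inl ?_⟩
    funext j
    fin_cases j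
    · simp [hend, tend0, hLz]
      ring
    · simp [hy, tend1]
  · intro i hi j hj
    have := (hbox i hi).2.1
    have := (tbox j hj).2.1
    omega
  · intro i hi
    rcases le_or_gt i m with him | him
    · rw [mirrorPin_glue_apply_of_le hγ him]
      obtain ⟨h1, h2, h3, h4⟩ := hbox i him
      exact ⟨h1, by omega, h3, by omega⟩
    · rw [mirrorPin_glue_apply_of_lt hγ him, Zd.reflAt_apply_same,
        Zd.reflAt_apply_of_ne (show (1 : Fin 2) ≠ 0 by decide)]
      obtain ⟨h1, h2, h3, h4⟩ := tbox (m + 1 + (m' + ε) - i) (by omega)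
      exact ⟨by omega, by omega, h3, by omega⟩

/-- **Column decoding of the head length.** A pin with head length `m` is in the columns `x ≤ X` up to time
`m` and on the column `x = X + 1` at time `m + 1`; so it is not a glued function (for any data) with a larger
head length `n` over a reach walk of width `X`. -/
theorem mirrorPin_pin_not_lt {X ε L m m' n q : ℕ} (hL : L = 2 * X + 1 + ε) {ω ω' ν t γ δ : ℕ → Site 2}
    (hγ : Glues[L, m, m' + ε, ω, EXT[ε, m', ω'], γ]) (hδ : Glues[L, n, q, ν, t, δ])
    (hω' : ω' ∈ RF[X, m']) (hν : ν ∈ RF[X, n]) (he : γ = δ) : ¬ m < n := fun hlt => by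
  have a := congrFun (congrFun he (m + 1)) 0
  rw [mirrorPin_glue_apply_of_lt hγ (Nat.lt_succ_self m), Zd.reflAt_apply_same,
    show m + 1 + (m' + ε) - (m + 1) = m' + ε by omega, (mirrorPin_ext_spec hω').2.2.1, hL,
    mirrorPin_glue_apply_of_le hδ (show m + 1 ≤ n by omega)] at a
  have b := ((Finset.mem_filter.1 hν).2.1 (m + 1) hlt).2.1
  push_cast at a
  omega

/-- **Decoding.** Two pairs of reach walks of width `X` with the same total length and the same pin are equal:
the head length is the last time before the column `x = X + 1` is reached, the head is read off directly and the
tail through the involution `reflAt 0 L`. -/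
theorem mirrorPin_pin_decode {X ε L m₁ m₁' m₂ m₂' : ℕ} (hL : L = 2 * X + 1 + ε) {ω₁ ω₁' ω₂ ω₂' γ₁ γ₂ : ℕ → Site 2}
    (hγ₁ : Glues[L, m₁, m₁' + ε, ω₁, EXT[ε, m₁', ω₁'], γ₁])
    (hγ₂ : Glues[L, m₂, m₂' + ε, ω₂, EXT[ε, m₂', ω₂'], γ₂])
    (h₁ : ω₁ ∈ RF[X, m₁]) (h₁' : ω₁' ∈ RF[X, m₁']) (h₂ : ω₂ ∈ RF[X, m₂]) (h₂' : ω₂' ∈ RF[X, m₂'])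
    (hn : m₁ + 1 + (m₁' + ε) = m₂ + 1 + (m₂' + ε)) (he : γ₁ = γ₂) :
    m₁ = m₂ ∧ ω₁ = ω₂ ∧ m₁' = m₂' ∧ ω₁' = ω₂' := by
  obtain rfl : m₁ = m₂ := le_antisymm (Nat.le_of_not_lt (mirrorPin_pin_not_lt hL hγ₂ hγ₁ h₂' h₁ he.symm))
    (Nat.le_of_not_lt (mirrorPin_pin_not_lt hL hγ₁ hγ₂ h₁' h₂ he))
  obtain rfl : m₁' = m₂' := by omega
  have hh : ∀ i ≤ m₁, ω₁ i = ω₂ i := fun i hi => by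
    have e := congrFun he i
    rwa [mirrorPin_glue_apply_of_le hγ₁ hi, mirrorPin_glue_apply_of_le hγ₂ hi] at e
  have ht : ∀ j ≤ m₁', ω₁' j = ω₂' j := fun j hj => by
    have e := congrFun he (m₁ + 1 + (m₁' + ε) - j)
    rw [mirrorPin_glue_apply_of_lt hγ₁ (by omega), mirrorPin_glue_apply_of_lt hγ₂ (by omega),
      show m₁ + 1 + (m₁' + ε) - (m₁ + 1 + (m₁' + ε) - j) = j by omega,
      mirrorPin_ext_apply_of_le hj, mirrorPin_ext_apply_of_le hj] at e
    exact Zd.reflAt_injective 0 _ e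
  refine ⟨rfl, funext fun i => ?_, rfl, funext fun j => ?_⟩
  · rcases le_or_gt i m₁ with hi | hi
    · exact hh i hi
    · rw [mirrorPin_reach_frozen h₁ i hi.le, mirrorPin_reach_frozen h₂ i hi.le, hh m₁ le_rfl]
  · rcases le_or_gt j m₁' with hj | hj
    · exact ht j hj
    · rw [mirrorPin_reach_frozen h₁' j hj.le, mirrorPin_reach_frozen h₂' j hj.le, ht m₁' le_rfl]

/-! ### Reflect-and-Schwarz: the abstract pairing inequality -/

/-- **Abstract reflect-and-Schwarz.** If pairs of sources with equal height map injectively into the targets,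
with `a · w(p) w(p') ≤ w(Φ p p')`, then `a (Σ_F w)² ≤ #Y · Σ_G w` where `Y` contains all heights
(Cauchy–Schwarz over the height classes). -/
theorem mirrorPin_schwarz_pairing {ι κ β : Type*} (F : Finset ι) (G : Finset κ) (Y : Finset β) (ht : ι → β)
    (wF : ι → ℝ) (wG : κ → ℝ) (a : ℝ) (Φ : ι → ι → κ) (ha : 0 ≤ a) (hY : ∀ p ∈ F, ht p ∈ Y)
    (hG : ∀ q ∈ G, 0 ≤ wG q)
    (hmaps : ∀ p ∈ F, ∀ p' ∈ F, ht p = ht p' → Φ p p' ∈ G ∧ a * (wF p * wF p') ≤ wG (Φ p p'))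
    (hinj : ∀ p₁ ∈ F, ∀ p₁' ∈ F, ∀ p₂ ∈ F, ∀ p₂' ∈ F, ht p₁ = ht p₁' → ht p₂ = ht p₂' →
      Φ p₁ p₁' = Φ p₂ p₂' → p₁ = p₂ ∧ p₁' = p₂') :
    a * (∑ p ∈ F, wF p) ^ 2 ≤ (Y.card : ℝ) * ∑ q ∈ G, wG q := by
  set A : β → ℝ := fun y => ∑ p ∈ F.filter (fun p => ht p = y), wF p with hA
  have hsum : ∑ p ∈ F, wF p = ∑ y ∈ Y, A y := (Finset.sum_fiberwise_of_maps_to hY wF).symm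
  set D : Finset (Σ _ : β, ι × ι) :=
    Y.sigma fun y => (F.filter (fun p => ht p = y)) ×ˢ (F.filter (fun p => ht p = y)) with hDdef
  have hD : ∀ d ∈ D, d.2.1 ∈ F ∧ d.2.2 ∈ F ∧ ht d.2.1 = d.1 ∧ ht d.2.2 = d.1 := fun d hd => by
    simp only [hDdef, Finset.mem_sigma, Finset.mem_product, Finset.mem_filter] at hd
    exact ⟨hd.2.1.1, hd.2.2.1, hd.2.1.2, hd.2.2.2⟩
  have h1 : a * ∑ y ∈ Y, A y ^ 2 = ∑ d ∈ D, a * (wF d.2.1 * wF d.2.2) := by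
    rw [Finset.sum_sigma, Finset.mul_sum]
    refine Finset.sum_congr rfl fun y _ => ?_
    simp only [hA]
    rw [sq, Finset.sum_mul_sum, ← Finset.sum_product', Finset.mul_sum]
  have h2 : ∑ d ∈ D, a * (wF d.2.1 * wF d.2.2) ≤ ∑ d ∈ D, wG (Φ d.2.1 d.2.2) :=
    Finset.sum_le_sum fun d hd => by
      obtain ⟨e1, e2, e3, e4⟩ := hD d hd
      exact (hmaps _ e1 _ e2 (e3.trans e4.symm)).2
  have h3 : ∑ d ∈ D, wG (Φ d.2.1 d.2.2) = ∑ q ∈ D.image (fun d => Φ d.2.1 d.2.2), wG q := by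
    refine (Finset.sum_image ?_).symm
    rintro ⟨y₁, p₁, p₁'⟩ hd₁ ⟨y₂, p₂, p₂'⟩ hd₂ h
    obtain ⟨a1, a2, a3, a4⟩ := hD _ (Finset.mem_coe.1 hd₁)
    obtain ⟨b1, b2, b3, b4⟩ := hD _ (Finset.mem_coe.1 hd₂)
    obtain ⟨rfl, rfl⟩ := hinj _ a1 _ a2 _ b1 _ b2 (a3.trans a4.symm) (b3.trans b4.symm) h
    dsimp only at a3 b3
    rw [← a3, ← b3]
  have h4 : ∑ q ∈ D.image (fun d => Φ d.2.1 d.2.2), wG q ≤ ∑ q ∈ G, wG q := by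
    refine Finset.sum_le_sum_of_subset_of_nonneg (fun q hq => ?_) fun q hq _ => hG q hq
    obtain ⟨d, hd, rfl⟩ := Finset.mem_image.1 hq
    obtain ⟨e1, e2, e3, e4⟩ := hD d hd
    exact (hmaps _ e1 _ e2 (e3.trans e4.symm)).1
  calc a * (∑ p ∈ F, wF p) ^ 2 = a * (∑ y ∈ Y, A y) ^ 2 := by rw [hsum]
    _ ≤ a * (Y.card * ∑ y ∈ Y, A y ^ 2) := mul_le_mul_of_nonneg_left sq_sum_le_card_mul_sum_sq ha
    _ = Y.card * (a * ∑ y ∈ Y, A y ^ 2) := by ring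
    _ ≤ Y.card * ∑ q ∈ G, wG q := by
      refine mul_le_mul_of_nonneg_left ?_ (Nat.cast_nonneg _)
      rw [h1]
      exact h2.trans (h3.le.trans h4)

/-- **The pairing bound for the two families**: with `L = 2X + 1 + ε`, `ε ≤ 1`,
`x_c^{1+ε} (Σ_{n ≤ N} Σ_{RF[X, n]} x_c^n)² ≤ (X + 1) · Σ_{n ≤ 2N+2} Σ_{TF[L, n]} x_c^n`. -/
theorem mirrorPin_mass_pairing {X ε L : ℕ} (hε : ε ≤ 1) (hL : L = 2 * X + 1 + ε) (N : ℕ) :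
    criticalFugacity ^ (ε + 1) *
        (∑ n ∈ Finset.range (N + 1), ∑ _ω ∈ RF[X, n], criticalFugacity ^ n) ^ 2 ≤
      ((X : ℝ) + 1) * ∑ n ∈ Finset.range (2 * N + 2 + 1), ∑ _ω ∈ TF[L, n], criticalFugacity ^ n := by
  have hY : ((Finset.Icc (0 : ℤ) X).card : ℝ) = X + 1 := by simp [Int.card_Icc]
  rw [Finset.sum_sigma', Finset.sum_sigma', ← hY]
  refine mirrorPin_schwarz_pairing _ _ (Finset.Icc (0 : ℤ) X) (fun p : (Σ _ : ℕ, ℕ → Site 2) => p.2 p.1 1) _ _ _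
    (fun p p' : (Σ _ : ℕ, ℕ → Site 2) => ⟨p.1 + 1 + (p'.1 + ε), fun i => if i ≤ p.1 then p.2 i else
      Zd.reflAt 0 L (EXT[ε, p'.1, p'.2] (p.1 + 1 + (p'.1 + ε) - i))⟩)
    (pow_nonneg criticalFugacity_pos.le _) ?_ (fun q _ => pow_nonneg criticalFugacity_pos.le _) ?_ ?_
  · rintro ⟨m, ω⟩ hp
    have h5 : 0 ≤ ω m 1 ∧ 5 * ω m 1 ≤ (X : ℤ) :=
      ((Finset.mem_filter.1 (Finset.mem_sigma.1 hp).2).2.1 m le_rfl).2.2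
    simp only [Finset.mem_Icc]
    omega
  · rintro ⟨m, ω⟩ hp ⟨m', ω'⟩ hp' hy
    simp only [Finset.mem_sigma, Finset.mem_range] at hp hp' hy ⊢
    exact ⟨⟨by omega, mirrorPin_pin_mem_tubeFam hL hε (fun _ => rfl) hp.2 hp'.2 hy⟩, le_of_eq (by ring)⟩
  · rintro ⟨m₁, ω₁⟩ h₁ ⟨m₁', ω₁'⟩ h₁' ⟨m₂, ω₂⟩ h₂ ⟨m₂', ω₂'⟩ h₂' - - he
    obtain ⟨hn, hγ⟩ := Sigma.mk.inj_iff.1 he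
    obtain ⟨rfl, rfl, rfl, rfl⟩ := mirrorPin_pin_decode hL (fun _ => rfl) (fun _ => rfl) (Finset.mem_sigma.1 h₁).2
      (Finset.mem_sigma.1 h₁').2 (Finset.mem_sigma.1 h₂).2 (Finset.mem_sigma.1 h₂').2 hn (eq_of_heq hγ)
    exact ⟨rfl, rfl⟩

/-! ### The straight walk and the final arithmetic -/

/-- The straight walk `0 → (L, 0)` alone gives `x_c^L ≤ Σ_{n ≤ L} Σ_{TF[L, n]} x_c^n`. -/
theorem mirrorPin_straight_term (L : ℕ) :
    criticalFugacity ^ L ≤ ∑ n ∈ Finset.range (L + 1), ∑ _ω ∈ TF[L, n], criticalFugacity ^ n := by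
  have hmem : Zd.straightWalk 2 L ∈ TF[L, L] := by
    rw [Finset.mem_filter, Zd.mem_sawFun_iff_mem_saws]
    refine ⟨⟨Zd.straightWalk_mem_saws 2 L, ?_⟩, fun i hi => ?_⟩
    · funext j
      fin_cases j <;> simp [Zd.straightWalk]
    · rw [show Zd.straightWalk 2 L i = Pi.single 0 (i : ℤ) by simp [Zd.straightWalk, min_eq_left hi]]
      simp only [Pi.single_eq_same, Pi.single_eq_of_ne (show (1 : Fin 2) ≠ 0 by decide), mul_zero]
      omega
  calc criticalFugacity ^ L ≤ ∑ _ω ∈ TF[L, L], criticalFugacity ^ L :=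
        Finset.single_le_sum (f := fun _ => criticalFugacity ^ L)
          (fun _ _ => pow_nonneg criticalFugacity_pos.le L) hmem
    _ ≤ ∑ n ∈ Finset.range (L + 1), ∑ _ω ∈ TF[L, n], criticalFugacity ^ n :=
        Finset.single_le_sum (f := fun n => ∑ _ω ∈ TF[L, n], criticalFugacity ^ n)
          (fun n _ => Finset.sum_nonneg fun _ _ => pow_nonneg criticalFugacity_pos.le n)
          (Finset.mem_range.2 (Nat.lt_succ_self L))

/-- **The final arithmetic**: from `S ≥ c X^{−C}` and `x^{1+ε} S² ≤ (X + 1) T` to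
`(x² c₁² / 2) L^{−(2C+1)} ≤ T` for `c₁ ≤ c`, `L = 2X + 1 + ε ≥ X ≥ 1`. -/
theorem mirrorPin_final_algebra {x c c₁ C S T : ℝ} {X ε L : ℕ} (hx0 : 0 < x) (hx1 : x ≤ 1) (hc₁ : 0 < c₁)
    (hc₁c : c₁ ≤ c) (hC : 0 ≤ C) (hX : 1 ≤ X) (hε : ε ≤ 1) (hL : L = 2 * X + 1 + ε)
    (hS : c * (X : ℝ) ^ (-C) ≤ S) (hT : x ^ (ε + 1) * S ^ 2 ≤ ((X : ℝ) + 1) * T) (hT0 : 0 ≤ T) :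
    x ^ 2 * c₁ ^ 2 / 2 * (L : ℝ) ^ (-(2 * C + 1)) ≤ T := by
  have hXpos : (0 : ℝ) < X := by exact_mod_cast hX
  have hX1 : (1 : ℝ) ≤ X := by exact_mod_cast hX
  set u : ℝ := (X : ℝ) ^ (-C) with hu
  have hu0 : 0 < u := Real.rpow_pos_of_pos hXpos _
  have hS1 : c₁ * u ≤ S := (mul_le_mul_of_nonneg_right hc₁c hu0.le).trans hS
  have hS2 : (c₁ * u) ^ 2 ≤ S ^ 2 := pow_le_pow_left₀ (by positivity) hS1 2
  have hx2 : x ^ 2 ≤ x ^ (ε + 1) := pow_le_pow_of_le_one hx0.le hx1 (by omega)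
  have hmain : x ^ 2 * (c₁ * u) ^ 2 ≤ 2 * X * T :=
    calc x ^ 2 * (c₁ * u) ^ 2 ≤ x ^ (ε + 1) * S ^ 2 :=
          mul_le_mul hx2 hS2 (by positivity) (by positivity)
      _ ≤ ((X : ℝ) + 1) * T := hT
      _ ≤ 2 * X * T := mul_le_mul_of_nonneg_right (by linarith) hT0
  have hLX : (L : ℝ) ^ (-(2 * C + 1)) ≤ (X : ℝ) ^ (-(2 * C + 1)) :=
    Real.rpow_le_rpow_of_nonpos hXpos (by rw [hL]; push_cast; linarith) (by linarith)
  have hXpow : (X : ℝ) ^ (-(2 * C + 1)) = u * u * (X : ℝ)⁻¹ := by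
    rw [show -(2 * C + 1) = (-C) + (-C) + (-1) by ring, Real.rpow_add hXpos, Real.rpow_add hXpos,
      Real.rpow_neg_one]
  calc x ^ 2 * c₁ ^ 2 / 2 * (L : ℝ) ^ (-(2 * C + 1))
      ≤ x ^ 2 * c₁ ^ 2 / 2 * (u * u * (X : ℝ)⁻¹) := by
        rw [← hXpow]
        exact mul_le_mul_of_nonneg_left hLX (by positivity)
    _ = x ^ 2 * (c₁ * u) ^ 2 / (2 * X) := by ring
    _ ≤ T := by
        rw [div_le_iff₀ (by positivity)]
        linarith

/-! ### The stub -/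

/-- **S3 `stub_mirrorPin`: `OneSidedReach → HalfTubePieceFloor`** (Madras–Slade 1993, Lemma 4.1.12,
reflect-and-Schwarz, applied once).  Witnesses: exponent `2C + 1`, constant `x_c² (min c 1)² / 2`, cut-off
`2 N_X + 2` for `L = 2X + 1 + ε ≥ 3` (resp. `L` for `L ≤ 2`, the straight walk); `x_c ≤ 1` because `μ ≥ 1`. -/
theorem stub_mirrorPin : OneSidedReach → HalfTubePieceFloor := by
  rintro ⟨C, c, hC, hc, hreach⟩
  have hx0 : 0 < criticalFugacity := criticalFugacity_pos
  have hx1 : criticalFugacity ≤ 1 :=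
    inv_le_one_of_one_le₀ (Zd.connectiveConstant_two ▸ Zd.one_le_connectiveConstant 2)
  have hc₁0 : 0 < min c 1 := lt_min hc one_pos
  refine ⟨2 * C + 1, criticalFugacity ^ 2 * (min c 1) ^ 2 / 2, by linarith, by positivity,
    fun L hL => ?_⟩
  obtain ⟨X, ε, hε, rfl⟩ : ∃ X ε : ℕ, ε ≤ 1 ∧ L = 2 * X + 1 + ε :=
    ⟨(L - 1) / 2, (L - 1) % 2, by omega, by omega⟩
  rcases Nat.eq_zero_or_pos X with rfl | hX
  · refine ⟨2 * 0 + 1 + ε, le_trans ?_ (mirrorPin_straight_term _)⟩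
    calc criticalFugacity ^ 2 * min c 1 ^ 2 / 2 * ((2 * 0 + 1 + ε : ℕ) : ℝ) ^ (-(2 * C + 1))
        ≤ criticalFugacity ^ 2 * min c 1 ^ 2 / 2 :=
          mul_le_of_le_one_right (by positivity) (Real.rpow_le_one_of_one_le_of_nonpos
            (by exact_mod_cast (show 1 ≤ 2 * 0 + 1 + ε by omega)) (by linarith))
      _ ≤ criticalFugacity ^ 2 := by
          nlinarith [pow_pos hx0 2, pow_le_one₀ (n := 2) hc₁0.le (min_le_right c 1)]
      _ ≤ _ := pow_le_pow_of_le_one hx0.le hx1 (by omega)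
  · obtain ⟨N, hN⟩ := hreach X hX
    exact ⟨2 * N + 2, mirrorPin_final_algebra hx0 hx1 hc₁0 (min_le_left c 1) hC hX hε rfl hN
      (mirrorPin_mass_pairing (X := X) hε rfl N)
      (Finset.sum_nonneg fun n _ => Finset.sum_nonneg fun _ _ => pow_nonneg hx0.le n)⟩

end Summit.CriticalPhenomena.SAWScalingLimit.Theorems.TubeLowerBound.LiebSimonStar

end
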